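import Summits.ValiantsHypothesis.ValiantsHypothesis.Theorems.ValuativeGCTValuativeFlipTwistPositivity
import Summits.ValiantsHypothesis.ValiantsHypothesis.Theorems.ValuativeGCTValuativeFlipTwistedInheritance
import Summits.ValiantsHypothesis.ValiantsHypothesis.Theorems.ValuativeGCTValuativeFlipEvalCertificates
import Literature.Computability.Complexity.OccurrenceObstructionsBIP
import Literature.Computability.AlgebraicComplexity.PlethysmLifting
import HarnessLib

/-!
# Twist positivity, III: per-anchor inheritance at EVERY padding — BLMW 2011 Problem 6.10 ("≥") for the
# padded permanent (crux `ValuativeGCT.ValuativeFlip`, stmt-ValiantsHypothesis-12624; wall-breaker k12 gen 1,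
# axis "representation-stability transfer between `m` and `m + 1`"; helper file `--supports`)

**Theorem (`perAnchorInheritance_every`, registered stub).**  For all `n, j, δ` and every `μ ⊢ n·δ` with at most
`n²` parts: `mult_{μ*} ℂ[Δ_n(per_n)] ≤ mult_{(μ♯(n+j))*} ℂ[Δ_{n+j}(X₀₀^j per_n)]` — at EVERY padding `j`, no
exceptions.  This is the "≥" (inheritance) half of BLMW 2011 Problem 6.10 for `g = per_n` (posed by Weyman;
labelled open in this crux's `DrefuteG2StubPerAnchorInheritance.md` and `AxisK12SizeTransfer.md`), and it upgrades
the tree's `eventualInheritance` (p119759: all but `≤ P·nδ` paddings) and the `m = n` case of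
`eventualPaddingTransfer`; it is the exact statement of the expired stub `stub_perAnchorInheritance` of line
`per-anchor-catch-up`.
Proof: `mult_{μ*} ℂ[Δ_n(per_n)] = dim H − dim(H ∩ I)` (`tp_orbitMultiplicity_eq_finrank_sub`, complete
reducibility); a basis of a complement of `K = H ∩ tw⁻¹ I` in `H` (`tw` = the Kadish–Landsberg twist
`(e_top + j)!/e_top!`, positive integers) gives linearly independent twisted evaluation functions on matrix space,
hence a nonsingular twisted certificate (`exists_det_eval_ne_zero_of_linearIndependent`) of size `dim H − dim K`,
so `stub_twistedInheritance` bounds the padded multiplicity below by `dim H − dim K ≥ dim H − dim (H ∩ I)`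
by twist positivity (`tp_finrank_inf_comap_twist_le`).  What stays FALSE: same-letter steps from a padded start
(`padding_step_monotonicity_fails`, this seat) — every-`j` inheritance is from the UNPADDED anchor.

Sources: BLMW, SIAM J. Comput. 40 (2011) §6.4 Problem 6.10; Kadish–Landsberg 2014 §2; Ikenmeyer–Panova 2017
Prop. 2.6(b); Bürgisser–Ikenmeyer–Panova 2019 §5; this seat's `Cruxes/ValuativeFlip/TwistPositivityK12G1.md`.
-/

set_option linter.dupNamespace false

namespace Summit.ValiantsHypothesis.ValiantsHypothesis.Theorems.ValuativeFlip

open scoped BigOperators Matrix ComplexConjugate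
open MvPolynomial
open Literature.NumberTheory.DiophantineGeometry
open Literature.Computability.AlgebraicComplexity
open Literature.Computability.Complexity

noncomputable section


/-! ## The multiplicity as `dim H - dim (H ∩ I)` -/

/-- **`mult_χ ℂ[Δ_n(f)] = dim HWV_χ - dim (HWV_χ ∩ I(GL·f))`** (complete reducibility: the highest-weight
vectors of the quotient are the images of those of `ℂ[Sym^n]`, `map_highestWeightSpace_eq_of_surjective`).
[BLMW 2011 §4.4; folklore] -/
theorem tp_orbitMultiplicity_eq_finrank_sub {σ : Type*} [Fintype σ] [LinearOrder σ] (f : MvPolynomial σ ℂ) {n : ℕ}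
    (hn : n ≠ 0) (χ : Weight σ) :
    orbitMultiplicity ℂ f n χ + Module.finrank ℂ ↥(highestWeightSpace (coordRep σ ℂ n) χ ⊓
        (orbitVanishingIdeal f n).restrictScalars ℂ) =
      Module.finrank ℂ ↥(highestWeightSpace (coordRep σ ℂ n) χ) := by
  classical
  set HW := highestWeightSpace (coordRep σ ℂ n) χ with hHW
  set I : Submodule ℂ (MvPolynomial (DegIdx σ n) ℂ) := (orbitVanishingIdeal f n).restrictScalars ℂ with hI
  haveI : FiniteDimensional ℂ ↥HW := finiteDimensional_highestWeightSpace_coordRep_holds (k := ℂ) (σ := σ) hn χ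
  let π := Literature.Computability.Complexity.mkIntertwiningMap (k := ℂ) f n
  have hsurj : Function.Surjective π := Ideal.Quotient.mk_surjective
  have hmap := map_highestWeightSpace_eq_of_surjective π hsurj (isSemisimpleRepresentation_coordRep n) χ
  -- rank–nullity for `π` restricted to `HW`
  let πH : ↥HW →ₗ[ℂ] OrbitCoordRing f n := π.toLinearMap ∘ₗ HW.subtype
  have hrange : LinearMap.range πH = highestWeightSpace (orbitCoordRep f n) χ := by
    rw [LinearMap.range_comp, Submodule.range_subtype, hmap]
  have hker : LinearMap.ker πH = (HW ⊓ I).comap HW.subtype := by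
    ext y
    rw [LinearMap.mem_ker, Submodule.mem_comap, Submodule.coe_subtype, Submodule.mem_inf]
    change Ideal.Quotient.mk (orbitVanishingIdeal f n) (y : MvPolynomial (DegIdx σ n) ℂ) = 0 ↔ _
    rw [Ideal.Quotient.eq_zero_iff_mem]
    exact ⟨fun h => ⟨y.2, h⟩, fun h => h.2⟩
  have hrn := LinearMap.finrank_range_add_finrank_ker πH
  rw [hrange, hker, LinearEquiv.finrank_eq (Submodule.comapSubtypeEquivOfLe (inf_le_left : HW ⊓ I ≤ HW))] at hrn
  exact hrn

/-! ## Every-`j` inheritance for the padded permanent -/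

/-- Composition of an evaluation with a diagonal rescaling. [folklore] -/
theorem tp_aeval_twist {ι : Type*} (x : ι → ℂ) (t : ι → ℂ) (F : MvPolynomial ι ℂ) :
    aeval x (aeval (fun e : ι => C (t e) * X e) F) = aeval (fun e => t e * x e) F := by
  rw [← AlgHom.comp_apply, MvPolynomial.comp_aeval]
  refine congrArg (fun q : ι → ℂ => aeval q F) (funext fun e => ?_)
  simp only [map_mul, aeval_C, aeval_X, Algebra.algebraMap_self, RingHom.id_apply]

/-- **Per-anchor inheritance at EVERY padding (BLMW 2011 Problem 6.10, the "≥" half, for the padded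
permanent).**  For all `n, j, δ` and every `μ ⊢ n·δ` with at most `n²` parts:
`mult_{μ*} ℂ[Δ_n(per_n)] ≤ mult_{(μ♯(n+j))*} ℂ[Δ_{n+j}(X₀₀^j per_n)]` — with NO exceptional paddings
(upgrading `eventualInheritance`, p119759, and the expired `stub_perAnchorInheritance` of line
`per-anchor-catch-up`).  Proof: twisted certificates of size `dim H − dim (H ∩ tw⁻¹ I)` exist
(`exists_det_eval_ne_zero_of_linearIndependent` + `stub_twistedInheritance`), and twist positivity
(`tp_finrank_inf_comap_twist_le`) bounds `dim (H ∩ tw⁻¹ I) ≤ dim (H ∩ I) = dim H − mult_{μ*} ℂ[Δ_n(per_n)]`.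
[this crux] -/
theorem perAnchorInheritance_every (n j δ : ℕ) [NeZero n] [NeZero (n + j)] (μ : Nat.Partition (n * δ))
    (hμ : μ.parts.card ≤ n * n) :
    orbitMultiplicity ℂ (paddedPerFormLex ℂ n n) n (partitionWeightLex n μ) ≤
      orbitMultiplicity ℂ (paddedPerFormLex ℂ n (n + j)) (n + j) (partitionWeightLex (n + j) (rowLift μ j)) := by
  classical
  set f := paddedPerFormLex ℂ n n with hf
  set χ := partitionWeightLex n μ with hχ
  set HW := highestWeightSpace (coordRep (MatIdx n) ℂ n) χ with hHW
  set Sd : Submodule ℂ (MvPolynomial (DegIdx (MatIdx n) n) ℂ) := homogeneousSubmodule (DegIdx (MatIdx n) n) ℂ δ with hSd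
  set I : Submodule ℂ (MvPolynomial (DegIdx (MatIdx n) n) ℂ) := (orbitVanishingIdeal f n).restrictScalars ℂ with hI
  let a : DegIdx (MatIdx n) n → ℕ := fun e => (e.1 (topMatIdx n) + j).descFactorial j
  have ha : ∀ e, 0 < a e := fun e =>
    Nat.pos_of_ne_zero ((Nat.descFactorial_eq_zero_iff_lt.not).mpr (by omega))
  set tw : MvPolynomial (DegIdx (MatIdx n) n) ℂ →ₐ[ℂ] MvPolynomial (DegIdx (MatIdx n) n) ℂ :=
    aeval (fun e => C ((a e : ℕ) : ℂ) * X e) with htw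
  have hn : n ≠ 0 := NeZero.ne n
  -- highest-weight vectors of weight `μ*` are forms of degree `δ`
  have hHWle : HW ≤ Sd := fun F hF => (mem_homogeneousSubmodule δ F).mpr
    (isHomogeneous_of_mem_highestWeightSpace hn hF (size_partitionWeightLex' μ hμ))
  haveI : FiniteDimensional ℂ ↥HW := finiteDimensional_highestWeightSpace_coordRep_holds (k := ℂ) hn χ
  -- twist positivity
  have hpos := tp_finrank_inf_comap_twist_le f n δ χ a ha
  rw [inf_eq_left.mpr hHWle] at hpos
  -- the subspace `K = HW ∩ tw⁻¹ I` and a complement `Q` inside `HW`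
  set K : Submodule ℂ (MvPolynomial (DegIdx (MatIdx n) n) ℂ) := HW ⊓ I.comap tw.toLinearMap with hK
  have hKle : K ≤ HW := inf_le_left
  obtain ⟨Q, hQ⟩ := Submodule.exists_isCompl (K.comap HW.subtype)
  have hdimKQ := Submodule.finrank_add_eq_of_isCompl hQ
  rw [LinearEquiv.finrank_eq (Submodule.comapSubtypeEquivOfLe hKle)] at hdimKQ
  haveI : FiniteDimensional ℂ ↥Q := FiniteDimensional.finiteDimensional_submodule Q
  haveI : Module.Free ℂ ↥Q := Module.Free.of_divisionRing ℂ ↥Q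
  let bQ := Module.finBasis ℂ ↥Q
  let F := fun i => (((bQ i : ↥Q) : ↥HW) : MvPolynomial (DegIdx (MatIdx n) n) ℂ)
  have hF : ∀ i, F i ∈ highestWeightSpace (coordRep (MatIdx n) ℂ n) (partitionWeightLex n μ) :=
    fun i => ((bQ i : ↥Q) : ↥HW).2
  -- the twisted evaluation functions
  let φ := fun i (A : Matrix (MatIdx n) (MatIdx n) ℂ) =>
    MvPolynomial.aeval (fun e : DegIdx (MatIdx n) n =>
      (((e.1 (topMatIdx n) + j).descFactorial j : ℕ) : ℂ) * MvPolynomial.coeff e.1 (linSubst (MatIdx n) ℂ A f)) (F i)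
  have hφtw : ∀ i A, φ i A = aeval (formCoeff n (linSubst (MatIdx n) ℂ A f)) (tw (F i)) := by
    intro i A
    rw [htw, tp_aeval_twist]
    simp only [φ, a, formCoeff_apply]
  have hφlin : LinearIndependent ℂ φ := by
    rw [Fintype.linearIndependent_iff]
    intro c hc
    -- `G = ∑ c_i F_i` has `tw G ∈ I`
    set Gq : ↥Q := ∑ i, c i • bQ i with hGq
    have hG : ((Gq : ↥HW) : MvPolynomial (DegIdx (MatIdx n) n) ℂ) = ∑ i, c i • F i := by
      simp only [hGq, Submodule.coe_sum, Submodule.coe_smul, F]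
    have htwG : tw (∑ i, c i • F i) ∈ orbitVanishingIdeal f n := by
      rw [mem_orbitVanishingIdeal_iff]
      intro g
      rw [linSubstRep_apply]
      have h0 := congrFun hc (g : Matrix (MatIdx n) (MatIdx n) ℂ)
      simp only [Finset.sum_apply, Pi.smul_apply, smul_eq_mul, Pi.zero_apply] at h0
      rw [map_sum, map_sum]
      simp only [map_smul, smul_eq_mul]
      rw [← h0]
      refine Finset.sum_congr rfl fun i _ => ?_
      rw [hφtw]
    have hGK : ((Gq : ↥HW) : MvPolynomial (DegIdx (MatIdx n) n) ℂ) ∈ K := by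
      refine ⟨((Gq : ↥HW)).2, ?_⟩
      change tw (((Gq : ↥HW) : MvPolynomial (DegIdx (MatIdx n) n) ℂ)) ∈ orbitVanishingIdeal f n
      rw [hG]
      exact htwG
    have hGq0 : Gq = 0 := by
      have hmem : (Gq : ↥HW) ∈ K.comap HW.subtype ⊓ Q := ⟨hGK, Gq.2⟩
      rw [hQ.inf_eq_bot, Submodule.mem_bot] at hmem
      exact (Submodule.coe_eq_zero).mp hmem
    rw [hGq] at hGq0
    intro i
    have hrepr := bQ.repr_sum_self c
    rw [hGq0, map_zero] at hrepr
    have hi := congrFun hrepr i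
    simp only [Finsupp.coe_zero, Pi.zero_apply] at hi
    exact hi.symm
  -- a nonsingular twisted evaluation matrix of size `D`, and twisted inheritance
  obtain ⟨A, hA⟩ := exists_det_eval_ne_zero_of_linearIndependent _ φ hφlin
  have hle := stub_twistedInheritance n j δ μ hμ _ F hF A hA
  -- the arithmetic
  have hmult : orbitMultiplicity ℂ f n χ + Module.finrank ℂ ↥(HW ⊓ I) = Module.finrank ℂ ↥HW :=
    tp_orbitMultiplicity_eq_finrank_sub f hn χ
  have hpos' : Module.finrank ℂ ↥K ≤ Module.finrank ℂ ↥(HW ⊓ I) := hpos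
  omega

end

end Summit.ValiantsHypothesis.ValiantsHypothesis.Theorems.ValuativeFlip
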